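import Literature.MathematicalPhysics.QuantumFieldTheory.Balaban1983to89.B9Ineq349SiteComposite
import Literature.MathematicalPhysics.QuantumFieldTheory.Balaban1983to89.B9Ineq349

/-!
# `Balaban1983to89.B9Ineq349SiteFromBlocks` — T. Bałaban, *Propagators for lattice gauge theories in a background field*, Commun. Math. Phys. **99**
# (1985) 389–434 [Balaban1985BackgroundPropagators], (3.49) p. 399: ROW 25 OF THE N06 TABLE DERIVED — the printed (3.49) for the GENUINE site-sector
# `P(U) = I − R(U) = G′Q′*(Q′G′²Q′*)⁻¹Q′G′` FROM BLOCK-COMPLETE Thm 3.1 ∕ Thm 3.2-TYPE INPUTS «using again Lemma 2.1» — [4]'s Lemma 2.1 ((2.60), (2.61),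
# (2.63)) DISCHARGED on the torus of the member, the three-factor power counting by g0's `B9Ineq349.comp3_kernel_pq`, and the family statement
# `B9.Stmt349Printed` at the record geometry `geo9Y` for n06-i's reading `p349SiteY`

statement-level skeleton of published theorems with citation tags; proofs where landed; nothing here is a claim about the Yang–Mills mass gap

THE PRINT (p. 399 [PDF 11]): *«These theorems [3.1, 3.2] imply all the properties of the operator R, or DRD*, we will need in the future.  For the
operator P = I − R we obtain, using again Lemma 2.1, [|P(x, x′)|, |(DP)_μ(x, x′)|, |(PD*)_ν(x, x′)|, |(DPD*)_{μν}(x, x′)|] ≤ O(1)[1, (L^jη)⁻¹, (L^jη)⁻¹,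
(L^jη)⁻²](L^{j′}η)^{−d}e^{−½δ₀d(y,y′)} for x ∈ Δ(y), y ∈ Λ_j, x′ ∈ Δ(y′), y′ ∈ Λ_{j′}. (3.49)»* (cell GAPS G-B9-12: derivation asserted, not displayed).
[4] = [Balaban1984PropagatorsII] Lemma 2.1 (2.60)–(2.63) p. 234.

WHAT IS PROVED (sorry-free).
* §1 ★★ `exists_threshold_349` — THE DERIVATION AT ONE CONFIGURATION, EVERY MEMBER ABOVE A THRESHOLD: for rates `δ₀, δ₁ > 0` there are `M₃, θ, C_g > 0`
  (depending on `d, L, δ₀, δ₁` only; `θ = min(δ₀, δ₁)∕8`) such that for every k-level index `i` with `L·M_h ≥ M₃`, every complete normed ℂ-algebra `𝔸`,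
  all letters `parS, Gp`, every `U` and `B₀, B₁ ≥ 0`: the three block-complete schemas of `B9Ineq349SiteComposite` at `U` — `Left342At` ((3.42) at
  `Q′*(δ⊗F)`), `Right342At` (its adjoint side), `Blk348At` ((3.48) for the genuine `C(U)`) — give, for EVERY block pair and every entry,
  `fineEntryS i (P349Y i parS Gp) U y y′ n ≤ B₀B₁B₀·C_g · [1, (Lʲη)⁻¹, (Lʲη)⁻¹, (Lʲη)⁻²]ₙ · (L^{j′}η)^{−d′} · e^{−θd(y,y′)}` — the printed right-hand side of (3.49)
  (rate `θ`; print's `½δ₀` needs `δ₁ = δ₀` and a finer `α`, cf. g0's `rates_349`).  Proof: the dictionary discharged (`fineEntryS_le_comp3_of_schemas`),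
  [4]'s Lemma 2.1 on the member's torus (`B6Geom246MultiLevelTorus.lemma21_torus`: (2.61) with the repaired constant `K261`, at `α = ½`,
  `δ = min(δ₀,δ₁)∕4`; (2.60) `B6Ineq288MultiLevelTorus.ineq260_geoBT`; the largeness `L⁴, L^{d′}, L² ≤ e^{½δ(RLM_h − 1)}` above the threshold), the scale
  transfers `B6Cor28.transfer_of_260`, the convolution `B9Ineq349.conv3_of_261`, and the power counting `B9Ineq349.comp3_kernel_pq` — the pattern of
  [4]'s certified (2.88) (`B6Ineq288MultiLevelTorus.ineq288_read_kLevelTorusP`), here for general `U` and the non-abelian fibre.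
* §2 the inputs as FAMILY statements in the mould of `B9.Thm31Printed ∕ Thm32Printed` (thresholds `M ≥ M₁`, `0 < α₀`, `Mα₀ ≤ a₀`, `U ∈ (3.35)`):
  `Thm31SiteSchemas c35 𝔏` (LEFT and RIGHT (3.42) schemas for `(𝔏 x).Gp, (𝔏 x).parS`, common `B₀, δ₀`) and `Thm32BlkSchema c35 𝔏` ((3.48) for the genuine
  `C(U)` over `(𝔏 x).parS, (𝔏 x).Gp`, all block pairs); bridging `geo9Y_len_eq_lenB`, `geo9Y_dist_eq_distB` (the record geometry's scale and distance at an
  index bond ARE the torus block data at its carrier block).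
* §3 ★★★ `stmt349Printed_site_of_blockSchemas` — ROW 25 DERIVED: `Thm31SiteSchemas c35 𝔏 → Thm32BlkSchema c35 𝔏 → B9.Stmt349Printed (d+1) c35 geo9Y
  (bg9Y 𝔸 G) (x ↦ p349SiteY 𝔸 G x (𝔏 x))` — print's (3.49) for the genuine `P = I − R(U)` of every letter family, read at the carrier blocks (n06-i's
  `B9Ineq349SiteReading`), from Thm 3.1 ∕ Thm 3.2-type block-complete inputs; at def-Y's records of record (`lettersYOfRecordDE`, n06-i's
  `opsYS349OfRecordDE`) it is the knit's row 25 modulo the two input binders.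

HONEST SCOPE.  The two inputs are HYPOTHESES (printed-type statements about the genuine letters: Thm 3.1's (3.42) at the test functions `Q′*(δ⊗F)`
and on the adjoint side — the latter located: print gets it from the self-adjointness of `G′(U)`, not typed for the abstract letter —, and Thm 3.2's
(3.48) at every block pair); everything else — the (3.25)-in-kernels dictionary, the units, Lemma 2.1 and the power counting — is PROVED.  Why not from
the knit's `t31 ∕ t32` as typed: those read `G′`, `C` through the index-bond map `β` (based blocks only) and on product-form test functions, which cannot
feed the intermediate block sums (dag-n06-i `ROW25-LOCATED.md` (O2); `B9BetaRangeKLevelV1`).  Count-neutral; NOT a node discharge; nothing continuum ∕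
OS ∕ mass-gap.  Filed by dag-n06-i gen 6 (pub-ymgap N06 bundle F4, row 25); a NEW file; nothing landed is modified.
-/

namespace Literature.MathematicalPhysics.QuantumFieldTheory.Balaban1983to89.B9Ineq349SiteFromBlocks

open Node00
open B6KLevelCensusIndexV1 (KIdx)
open B6Geom246MultiLevelBox (bset blkOf)
open B6Geom246MultiLevelTorus (geomT lemma21_torus)
open B6Ineq2142KLevelV1 (β lvl beta_level)
open B6Prop22KLevelTorusCensus (KTIdx)
open B6Prop22KLevelTorusCensusEta (nKT nKT_pos)
open B6Ineq288MultiLevelTorus (geoBT geoBT_len geoBT_dist geoBT_M geoBT_L geoBT_eta geoBT_RM dist_nonneg_geoBT dist_symm_geoBT triangle_geoBT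
  ineq260_geoBT)
open B6Ineq261LevelGap (K261 K261_nonneg theta_lt_one_of_log)
open B6Cor28 (comp3 TransferL TransferR Conv3 transfer_of_260)
open B9Ineq349 (powL powR comp3_kernel_pq conv3_of_261 transferL_mono powR_bounds pref4inv_eq_rpow)
open B9Ineq349SiteReading (fineEntryS p349SiteY fineKernelOfSiteOp)
open B9Ineq349SiteComposite (lenB distB lenB_eq lenB_pos distB_nonneg etaS_pos Left342At Right342At Blk348At modelK₁ modelK₂ modelK₃ ea349 eb349
  modelK₁_nonneg modelK₂_nonneg modelK₃_nonneg comp3_model_nonneg fineEntryS_le_comp3_of_schemas)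
open B9PinMembersKLevelV1 (MemberY geo9Y bg9Y)
open scoped Matrix

noncomputable section

variable {d ℓ : ℕ} {hd : 1 ≤ d + 1} {hL : Odd (ℓ + 1) ∧ 1 < ℓ + 1} {b₀ b₁ : ℝ} {Mstar : ℕ}

/-! ## §1 (3.49) at one configuration for every member above a threshold: Lemma 2.1 and the power counting discharged -/

section OneU

/-- `t^m ≤ e^{E}` once `m·log t ≤ E` (`t > 0`). [cite: Balaban1984PropagatorsII, (2.59) p.233, bookkeeping] -/
private theorem rpow_le_exp_of_mul_log_le {t m E : ℝ} (ht : 0 < t) (h : m * Real.log t ≤ E) : t ^ m ≤ Real.exp E := by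
  rw [Real.rpow_def_of_pos ht]
  exact Real.exp_le_exp.2 (by rw [mul_comm]; exact h)

/-- the left model power IS g0's `powL` as a real power: `ℓ^{ea349 n} = ℓ^{powL n}`. [cite: Balaban1985BackgroundPropagators, (3.42) p.397, bookkeeping] -/
theorem pow_ea349_eq_rpow (t : ℝ) (n : Fin 4) : t ^ ea349 n = t ^ powL n := by
  fin_cases n
  · show t ^ 2 = t ^ (2 : ℝ); exact (Real.rpow_two t).symm
  · show t ^ 1 = t ^ (1 : ℝ); rw [pow_one, Real.rpow_one]
  · show t ^ 2 = t ^ (2 : ℝ); exact (Real.rpow_two t).symm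
  · show t ^ 1 = t ^ (1 : ℝ); rw [pow_one, Real.rpow_one]

/-- the right model power IS g0's `powR`: `ℓ^{eb349 n} = ℓ^{powR n}`. [cite: Balaban1985BackgroundPropagators, (3.42) p.397, bookkeeping] -/
theorem pow_eb349_eq_rpow (t : ℝ) (n : Fin 4) : t ^ eb349 n = t ^ powR n := by
  fin_cases n
  · show t ^ 2 = t ^ (2 : ℝ); exact (Real.rpow_two t).symm
  · show t ^ 2 = t ^ (2 : ℝ); exact (Real.rpow_two t).symm
  · show t ^ 1 = t ^ (1 : ℝ); rw [pow_one, Real.rpow_one]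
  · show t ^ 1 = t ^ (1 : ℝ); rw [pow_one, Real.rpow_one]

/-- `d(y, y″) ≤ d(y, y′) + d(y′, y″)` for the blocks of a member ([4] (2.54), the torus realisation). [cite: Balaban1984PropagatorsII, (2.54) p.233] -/
theorem distB_triangle (i : KIdx d ℓ hd hL b₀ b₁) (a b c : BlkY i) : distB i a c ≤ distB i a b + distB i b c :=
  triangle_geoBT (toKT i) a b c
set_option maxHeartbeats 400000 in
/-- ★★ **(3.49) AT ONE CONFIGURATION FROM THE BLOCK-COMPLETE SCHEMAS, EVERY MEMBER ABOVE A THRESHOLD — LEMMA 2.1 AND THE POWER COUNTING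
DISCHARGED**: for `δ₀, δ₁ > 0` there are `M₃, θ, C_g > 0` (`θ = min(δ₀,δ₁)∕8 ≤ δ₀`; functions of `d, L, δ₀, δ₁` only) such that for every index `i` with
`L·M_h ≥ M₃`, every fibre `𝔸`, all `parS, Gp, U` and `B₀, B₁ ≥ 0`, the schemas `Left342At`, `Right342At` (with `B₀, δ₀`) and `Blk348At` (with `B₁, δ₁`) imply
`fineEntryS i (P349Y i parS Gp) U y y′ n ≤ B₀B₁B₀·C_g·[1, (Lʲη)⁻¹, (Lʲη)⁻¹, (Lʲη)⁻²]ₙ·(L^{j′}η)^{−d′}·e^{−θd(y,y′)}` for all blocks `y, y′` and entries `n`.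
[cite: Balaban1985BackgroundPropagators, (3.49) p.399 («using again Lemma 2.1»); Balaban1984PropagatorsII, Lemma 2.1 (2.60)–(2.63) p.234, (2.88) p.238] -/
theorem exists_threshold_349 {δ₀ δ₁ : ℝ} (hδ₀ : 0 < δ₀) (hδ₁ : 0 < δ₁) :
    ∃ M₃ θ Cg : ℝ, 0 < M₃ ∧ 0 < θ ∧ 0 < Cg ∧ θ ≤ δ₀ ∧
      ∀ i : KIdx d ℓ hd hL b₀ b₁, M₃ ≤ ((ℓ : ℝ) + 1) * i.Mh →
        ∀ {𝔸 : Type} [NormedRing 𝔸] [NormedAlgebra ℂ 𝔸] [CompleteSpace 𝔸]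
          (parS : SiteParY 𝔸 i) (Gp : SiteOpY 𝔸 i) (U : CfgY 𝔸 i) {B₀ B₁ : ℝ}, 0 ≤ B₀ → 0 ≤ B₁ →
          Left342At i parS Gp U B₀ δ₀ → Right342At i parS Gp U B₀ δ₀ → Blk348At i parS Gp U B₁ δ₁ →
          ∀ (n : Fin 4) (s s' : BlkY i), fineEntryS i (P349Y i parS Gp) U s s' n ≤
            B₀ * B₁ * B₀ * Cg * B9.pref4inv (lenB i s) n * lenB i s' ^ (-((d + 1 : ℕ) : ℝ)) * Real.exp (-(θ * distB i s s')) := by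
  have hℓ1 : 1 ≤ ℓ := by have := hL.2; omega
  have hL0 : (0 : ℝ) < (ℓ : ℝ) + 1 := by positivity
  have hL1 : (1 : ℝ) ≤ (ℓ : ℝ) + 1 := by linarith [(Nat.cast_nonneg ℓ : (0 : ℝ) ≤ ℓ)]
  have hlog : Real.log ((ℓ : ℝ) + 1) ≤ (ℓ : ℝ) + 1 := (Real.log_le_sub_one_of_pos hL0).trans (by linarith)
  have hlog0 : 0 ≤ Real.log ((ℓ : ℝ) + 1) := Real.log_nonneg hL1
  -- the rate of Lemma 2.1: `δ = min(δ₀, δ₁)/4`, `α = ½`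
  obtain ⟨δ, hδ⟩ : ∃ δ : ℝ, δ = min δ₀ δ₁ / 4 := ⟨_, rfl⟩
  have hδpos : 0 < δ := by rw [hδ]; exact div_pos (lt_min hδ₀ hδ₁) (by norm_num)
  have hδa : δ + 2 * (1 / 2 * δ) ≤ δ₀ := by
    have : min δ₀ δ₁ ≤ δ₀ := min_le_left _ _
    rw [hδ]; linarith
  have hδb : δ + 1 / 2 * δ ≤ δ₁ := by
    have : min δ₀ δ₁ ≤ δ₁ := min_le_right _ _
    rw [hδ]; linarith
  -- the (2.59)-type threshold for (2.61) at `(δ, ½)` and the largeness threshold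
  obtain ⟨N₁, hN₁⟩ : ∃ N₁ : ℕ, N₁ = ⌈8 * ((d : ℝ) + 1) * ((ℓ : ℝ) + 1) / δ⌉₊ + 1 := ⟨_, rfl⟩
  have hN₁pos : 0 < N₁ := by rw [hN₁]; omega
  have hN₁ge : 8 * ((d : ℝ) + 1) * ((ℓ : ℝ) + 1) < δ * (N₁ : ℝ) := by
    have h : 8 * ((d : ℝ) + 1) * ((ℓ : ℝ) + 1) / δ < (N₁ : ℝ) := by
      rw [hN₁]; push_cast; exact lt_of_le_of_lt (Nat.le_ceil _) (by linarith)
    rw [div_lt_iff₀ hδpos] at h; linarith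
  have hθ1 : Real.exp (-(1 / 2 * δ)) * ((ℓ : ℝ) + 1) ^ ((2 * (d + 1 : ℕ) : ℝ) / N₁) < 1 := by
    refine theta_lt_one_of_log hL0 hN₁pos ?_
    push_cast
    have hd0 : (0 : ℝ) ≤ 2 * ((d : ℝ) + 1) := by positivity
    have h1 := mul_le_mul_of_nonneg_left hlog hd0
    have h2 : (0 : ℝ) ≤ ((d : ℝ) + 1) * ((ℓ : ℝ) + 1) := by positivity
    linarith
  obtain ⟨N₂, hN₂⟩ : ∃ N₂ : ℕ, N₂ = ⌈2 * ((d : ℝ) + 5) * ((ℓ : ℝ) + 1) / δ⌉₊ := ⟨_, rfl⟩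
  have hN₂ge : 2 * ((d : ℝ) + 5) * ((ℓ : ℝ) + 1) ≤ δ * (N₂ : ℝ) := by
    have h : 2 * ((d : ℝ) + 5) * ((ℓ : ℝ) + 1) / δ ≤ (N₂ : ℝ) := by rw [hN₂]; exact Nat.le_ceil _
    rw [div_le_iff₀ hδpos] at h; linarith
  obtain ⟨cL, hcL⟩ : ∃ cL : ℝ, cL = K261 N₁ (d + 1) ((ℓ : ℝ) + 1) 1 (1 / 2 * δ) := ⟨_, rfl⟩
  have hcL0 : 0 ≤ cL := by rw [hcL]; exact K261_nonneg (by positivity) zero_le_one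
  obtain ⟨M₃, hM₃⟩ : ∃ M₃ : ℝ, M₃ = max ((N₁ : ℝ) + 1) ((N₂ : ℝ) + 1) := ⟨_, rfl⟩
  have hM₃pos : 0 < M₃ := by rw [hM₃]; exact lt_max_of_lt_left (by positivity)
  obtain ⟨Cg, hCg⟩ : ∃ Cg : ℝ, Cg = ((ℓ : ℝ) + 1) ^ (4 : ℝ) * ((ℓ : ℝ) + 1) ^ ((d + 1 : ℕ) : ℝ) * ((ℓ : ℝ) + 1) ^ (2 : ℝ) * cL ^ 3 + 1 :=
    ⟨_, rfl⟩
  have hCgbase : 0 ≤ ((ℓ : ℝ) + 1) ^ (4 : ℝ) * ((ℓ : ℝ) + 1) ^ ((d + 1 : ℕ) : ℝ) * ((ℓ : ℝ) + 1) ^ (2 : ℝ) * cL ^ 3 := by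
    have := Real.rpow_nonneg hL0.le (4 : ℝ)
    have := Real.rpow_nonneg hL0.le ((d + 1 : ℕ) : ℝ)
    have := Real.rpow_nonneg hL0.le (2 : ℝ)
    positivity
  have hCgpos : 0 < Cg := by rw [hCg]; linarith
  have hθδ₀ : 1 / 2 * δ ≤ δ₀ := by linarith
  refine ⟨M₃, 1 / 2 * δ, Cg, hM₃pos, by positivity, hCgpos, hθδ₀, ?_⟩
  intro i hM 𝔸 _ _ _ parS Gp U B₀ B₁ hB₀ hB₁ hLe hRi h348 n s s'
  -- the member's thresholds (`toKT i` is the torus index of the member)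
  have hR1 : 1 ≤ i.R := le_trans (by omega) (toKT i).hR
  have hNle : ∀ N : ℕ, (N : ℝ) + 1 ≤ ((ℓ : ℝ) + 1) * i.Mh → N + 1 ≤ i.R * ((ℓ + 1) * i.Mh) := by
    intro N hN
    have h1 : ((N + 1 : ℕ) : ℝ) ≤ (((ℓ + 1) * i.Mh : ℕ) : ℝ) := by push_cast; exact hN
    have h2 : N + 1 ≤ (ℓ + 1) * i.Mh := by exact_mod_cast h1
    exact h2.trans (Nat.le_mul_of_pos_left _ hR1)
  have hRM1 : N₁ + 1 ≤ (toKT i).R * ((ℓ + 1) * (toKT i).Mh) := hNle N₁ ((le_max_left _ _).trans (hM₃ ▸ hM))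
  have hRM2 : N₂ + 1 ≤ i.R * ((ℓ + 1) * i.Mh) := hNle N₂ ((le_max_right _ _).trans (hM₃ ▸ hM))
  -- Lemma 2.1 on the torus of the member at `(δ, ½)`: (2.61) with the repaired constant; (2.60) for `geoBT`
  obtain ⟨-, h261, -, -⟩ :=
    lemma21_torus i.D (toKT i).hMh (toKT i).hP hN₁pos hRM1 hδpos.le (α := 1 / 2) (by norm_num) (by norm_num) hθ1
  have h261B : ∀ y : BlkY i, ∑ y' : BlkY i, Real.exp (-(1 / 2 * δ * distB i y y')) ≤ cL := by
    rw [hcL]; exact fun y => h261 y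
  have h260B : B6RandomWalk.Ineq260 (geoBT (toKT i)) δ (1 / 2) := ineq260_geoBT (toKT i) (by positivity)
  -- the largeness `L⁴, L^{d′}, L² ≤ e^{½δ·RM}`, `RM = R·L·M_h − 1 ≥ N₂`
  have hge : (N₂ : ℝ) ≤ (i.R : ℝ) * (((ℓ : ℝ) + 1) * i.Mh) - 1 := by
    have : ((N₂ + 1 : ℕ) : ℝ) ≤ ((i.R * ((ℓ + 1) * i.Mh) : ℕ) : ℝ) := by exact_mod_cast hRM2
    push_cast at this; linarith
  have hE : ((d : ℝ) + 5) * Real.log ((ℓ : ℝ) + 1) ≤ 1 / 2 * δ * (geoBT (toKT i)).R * (geoBT (toKT i)).M := by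
    rw [mul_assoc (1 / 2 * δ), geoBT_RM]
    have hge' : (N₂ : ℝ) ≤ ((toKT i).R : ℝ) * (((ℓ : ℝ) + 1) * (toKT i).Mh) - 1 := hge
    have h3 := mul_le_mul_of_nonneg_left hge' (by positivity : (0 : ℝ) ≤ 1 / 2 * δ)
    have hd5 : (0 : ℝ) ≤ (d : ℝ) + 5 := by positivity
    have h4 := mul_le_mul_of_nonneg_left hlog hd5
    linarith
  have hl4 : (geoBT (toKT i)).L ^ (4 : ℝ) ≤ Real.exp (1 / 2 * δ * (geoBT (toKT i)).R * (geoBT (toKT i)).M) := by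
    rw [geoBT_L]; refine rpow_le_exp_of_mul_log_le hL0 (le_trans ?_ hE); nlinarith
  have hld : (geoBT (toKT i)).L ^ ((d + 1 : ℕ) : ℝ) ≤ Real.exp (1 / 2 * δ * (geoBT (toKT i)).R * (geoBT (toKT i)).M) := by
    rw [geoBT_L]; refine rpow_le_exp_of_mul_log_le hL0 (le_trans ?_ hE); push_cast; nlinarith
  have hl2 : (geoBT (toKT i)).L ^ (2 : ℝ) ≤ Real.exp (1 / 2 * δ * (geoBT (toKT i)).R * (geoBT (toKT i)).M) := by
    rw [geoBT_L]; refine rpow_le_exp_of_mul_log_le hL0 (le_trans ?_ hE); nlinarith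
  -- the scale transfers from (2.60): constants `L⁴`, `L^{d′}`, `L^{q} ≤ L²`
  have hLg : 1 ≤ (geoBT (toKT i)).L := by rw [geoBT_L]; exact hL1
  have hηg : 0 < (geoBT (toKT i)).eta := by rw [geoBT_eta]; exact inv_pos.2 (by exact_mod_cast nKT_pos (toKT i))
  have e4 : |(-(4 : ℝ))| = 4 := by norm_num
  have ed : |(-((d + 1 : ℕ) : ℝ))| = ((d + 1 : ℕ) : ℝ) := by rw [abs_neg]; exact abs_of_nonneg (Nat.cast_nonneg _)
  have hT₄ := (transfer_of_260 (geoBT (toKT i)).scale (geoBT (toKT i)).dist (geoBT (toKT i)).L (geoBT (toKT i)).eta (1 / 2 * δ)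
    (geoBT (toKT i)).R (geoBT (toKT i)).M (-(4 : ℝ)) hLg hηg (by rw [e4]; exact hl4) h260B).2
  have hTd := (transfer_of_260 (geoBT (toKT i)).scale (geoBT (toKT i)).dist (geoBT (toKT i)).L (geoBT (toKT i)).eta (1 / 2 * δ)
    (geoBT (toKT i)).R (geoBT (toKT i)).M (-((d + 1 : ℕ) : ℝ)) hLg hηg (by rw [ed]; exact hld) h260B).1
  rw [e4] at hT₄
  rw [ed] at hTd
  rw [← B6Cor28.len_eq_rpow] at hT₄ hTd
  have hlen : ∀ y : BlkY i, 0 < lenB i y := lenB_pos i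
  have hTq : TransferL (lenB i) (distB i) (1 / 2 * δ) (powR n) ((geoBT (toKT i)).L ^ (2 : ℝ)) := by
    obtain ⟨hq0, hq2⟩ := powR_bounds n
    have hq : |powR n| = powR n := abs_of_nonneg hq0
    have hL2 : (geoBT (toKT i)).L ^ powR n ≤ (geoBT (toKT i)).L ^ (2 : ℝ) := Real.rpow_le_rpow_of_exponent_le hLg hq2
    have hlq : (geoBT (toKT i)).L ^ |powR n| ≤ Real.exp (1 / 2 * δ * (geoBT (toKT i)).R * (geoBT (toKT i)).M) := by
      rw [hq]; exact hL2.trans hl2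
    have hT := (transfer_of_260 (geoBT (toKT i)).scale (geoBT (toKT i)).dist (geoBT (toKT i)).L (geoBT (toKT i)).eta (1 / 2 * δ)
      (geoBT (toKT i)).R (geoBT (toKT i)).M (powR n) hLg hηg hlq h260B).2
    rw [hq, ← B6Cor28.len_eq_rpow] at hT
    exact transferL_mono (lenB i) (distB i) (1 / 2 * δ) (powR n) _ _ hlen hL2 hT
  -- the convolution (2.63) from (2.61) and (2.54)
  have hconv : Conv3 (distB i) δ (cL ^ 3) ((1 - 1 / 2) * δ) :=
    conv3_of_261 (distB i) (distB_triangle i) δ (1 / 2) cL hδpos.le (by norm_num) h261B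
  -- the three kernel bounds (the model kernels, exactly)
  have hK₁ : ∀ y y₁ : BlkY i, |modelK₁ i B₀ δ₀ n y y₁| ≤ B₀ * lenB i y ^ powL n * Real.exp (-(δ₀ * distB i y y₁)) := by
    intro y y₁
    rw [abs_of_nonneg (modelK₁_nonneg hB₀ δ₀ n y y₁)]
    unfold modelK₁; rw [pow_ea349_eq_rpow (lenB i y) n]
  have hK₂ : ∀ y₁ y₂ : BlkY i, |modelK₂ i B₁ δ₁ y₁ y₂| ≤
      B₁ * lenB i y₁ ^ (-(4 : ℝ)) * lenB i y₂ ^ (-((d + 1 : ℕ) : ℝ)) * Real.exp (-(δ₁ * distB i y₁ y₂)) := by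
    intro y₁ y₂
    rw [abs_of_nonneg (modelK₂_nonneg hB₁ δ₁ y₁ y₂)]
    rfl
  have hK₃ : ∀ y₂ y' : BlkY i, |modelK₃ i B₀ δ₀ n y₂ y'| ≤ B₀ * lenB i y' ^ powR n * Real.exp (-(δ₀ * distB i y₂ y')) := by
    intro y₂ y'
    rw [abs_of_nonneg (modelK₃_nonneg hB₀ δ₀ n y₂ y')]
    unfold modelK₃; rw [pow_eb349_eq_rpow (lenB i y') n]
  -- the power counting
  have hLnn : 0 ≤ (geoBT (toKT i)).L := le_trans zero_le_one hLg
  have main := comp3_kernel_pq (lenB i) (distB i) (d + 1) (modelK₁ i B₀ δ₀ n) (modelK₂ i B₁ δ₁) (modelK₃ i B₀ δ₀ n)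
    (powL n) (powR n) B₀ B₁ B₀ δ₀ δ₁ δ₀ (1 / 2 * δ) δ ((geoBT (toKT i)).L ^ (4 : ℝ)) ((geoBT (toKT i)).L ^ ((d + 1 : ℕ) : ℝ))
    ((geoBT (toKT i)).L ^ (2 : ℝ)) (cL ^ 3) ((1 - 1 / 2) * δ) hlen (distB_nonneg i) (distB_triangle i) hB₀ hB₁ hB₀
    (Real.rpow_nonneg hLnn _) (Real.rpow_nonneg hLnn _) (Real.rpow_nonneg hLnn _) (by positivity) hδa hδb hδa hK₁ hK₂ hK₃ hT₄ hTd hTq hconv s s'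
  -- assembly
  have hdict := fineEntryS_le_comp3_of_schemas hB₀ hB₁ hLe hRi h348 n s s'
  have hpref : lenB i s ^ (powL n + powR n - 4) = B9.pref4inv (lenB i s) n := (pref4inv_eq_rpow (lenB i s) (hlen s) n).symm
  have hrate : (1 - 1 / 2) * δ = 1 / 2 * δ := by ring
  rw [geoBT_L] at main
  have hrest : 0 ≤ B9.pref4inv (lenB i s) n * lenB i s' ^ (-((d + 1 : ℕ) : ℝ)) * Real.exp (-(1 / 2 * δ * distB i s s')) := by
    rw [← hpref]
    have := Real.rpow_nonneg (hlen s).le (powL n + powR n - 4)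
    have := Real.rpow_nonneg (hlen s').le (-((d + 1 : ℕ) : ℝ))
    positivity
  have hCle : ((ℓ : ℝ) + 1) ^ (4 : ℝ) * ((ℓ : ℝ) + 1) ^ ((d + 1 : ℕ) : ℝ) * ((ℓ : ℝ) + 1) ^ (2 : ℝ) * cL ^ 3 ≤ Cg := by rw [hCg]; linarith
  calc fineEntryS i (P349Y i parS Gp) U s s' n
      ≤ comp3 (modelK₁ i B₀ δ₀ n) (modelK₂ i B₁ δ₁) (modelK₃ i B₀ δ₀ n) s s' := hdict
    _ ≤ |comp3 (modelK₁ i B₀ δ₀ n) (modelK₂ i B₁ δ₁) (modelK₃ i B₀ δ₀ n) s s'| := le_abs_self _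
    _ ≤ B₀ * B₁ * B₀ * ((ℓ : ℝ) + 1) ^ (4 : ℝ) * ((ℓ : ℝ) + 1) ^ ((d + 1 : ℕ) : ℝ) * ((ℓ : ℝ) + 1) ^ (2 : ℝ) * cL ^ 3 *
          lenB i s ^ (powL n + powR n - 4) * lenB i s' ^ (-((d + 1 : ℕ) : ℝ)) * Real.exp (-((1 - 1 / 2) * δ * distB i s s')) := main
    _ = B₀ * B₁ * B₀ * (((ℓ : ℝ) + 1) ^ (4 : ℝ) * ((ℓ : ℝ) + 1) ^ ((d + 1 : ℕ) : ℝ) * ((ℓ : ℝ) + 1) ^ (2 : ℝ) * cL ^ 3) *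
          (B9.pref4inv (lenB i s) n * lenB i s' ^ (-((d + 1 : ℕ) : ℝ)) * Real.exp (-(1 / 2 * δ * distB i s s'))) := by
        rw [hpref, hrate]; ring
    _ ≤ B₀ * B₁ * B₀ * Cg * (B9.pref4inv (lenB i s) n * lenB i s' ^ (-((d + 1 : ℕ) : ℝ)) * Real.exp (-(1 / 2 * δ * distB i s s'))) := by
        have hBBB : 0 ≤ B₀ * B₁ * B₀ := by positivity
        exact mul_le_mul_of_nonneg_right (mul_le_mul_of_nonneg_left hCle hBBB) hrest
    _ = _ := by ring

end OneU

/-! ## §2 The inputs as family statements; the record geometry's scale and distance at an index bond -/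

section Family

variable (𝔸 : Type) [NormedRing 𝔸] [NormedAlgebra ℂ 𝔸] [CompleteSpace 𝔸] (G : Subgroup 𝔸ˣ)

/-- **THM 3.1-TYPE INPUT FOR (3.49) AS A FAMILY STATEMENT**: under the printed prefix of Thm 3.1 («M ≥ M₁, 0 < α₀, Mα₀ ≤ a₀, U in the class (3.35)»), the
LEFT (3.42) schema (entries `|G′λ|`, `|∇_UG′λ|` at `λ = Q′*_U(δ_{y}⊗F)`, all block pairs) AND the RIGHT adjoint-side schema hold for the letters
`(𝔏 x).Gp`, `(𝔏 x).parS` with common constants `B₀, δ₀`.  Hypothesis shape (Thm 3.1 (3.42) restricted to these arguments; the adjoint side located: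
print's self-adjointness of `G′(U)`). [cite: Balaban1985BackgroundPropagators, Thm 3.1 (3.42) p.397 with (3.25) p.394] -/
def Thm31SiteSchemas (c35 : ℝ) (𝔏 : ∀ x : MemberY d ℓ hd hL b₀ b₁ Mstar, CovLettersY 𝔸 x) : Prop :=
  ∃ M₁ δ₀ a₀ B₀ : ℝ, 0 < M₁ ∧ 0 < δ₀ ∧ 0 < a₀ ∧ 0 < B₀ ∧
    ∀ x : MemberY d ℓ hd hL b₀ b₁ Mstar, M₁ ≤ (geo9Y x).M → ∀ α₀ : ℝ, 0 < α₀ → (geo9Y x).M * α₀ ≤ a₀ →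
      ∀ U : (bg9Y 𝔸 G x).Cfg, (bg9Y 𝔸 G x).Reg335 c35 α₀ U →
        Left342At x.toKIdx (𝔏 x).parS (𝔏 x).Gp U B₀ δ₀ ∧ Right342At x.toKIdx (𝔏 x).parS (𝔏 x).Gp U B₀ δ₀

/-- **THM 3.2-TYPE INPUT FOR (3.49) AS A FAMILY STATEMENT**: under the same prefix, (3.48) for the GENUINE `C(U) = CY … (𝔏 x).parS (𝔏 x).Gp U` at EVERY
block pair.  Hypothesis shape (Thm 3.2, block-complete). [cite: Balaban1985BackgroundPropagators, Thm 3.2 (3.48) p.398] -/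
def Thm32BlkSchema (c35 : ℝ) (𝔏 : ∀ x : MemberY d ℓ hd hL b₀ b₁ Mstar, CovLettersY 𝔸 x) : Prop :=
  ∃ M₁ δ₁ a₀ B₁ : ℝ, 0 < M₁ ∧ 0 < δ₁ ∧ 0 < a₀ ∧ 0 < B₁ ∧
    ∀ x : MemberY d ℓ hd hL b₀ b₁ Mstar, M₁ ≤ (geo9Y x).M → ∀ α₀ : ℝ, 0 < α₀ → (geo9Y x).M * α₀ ≤ a₀ →
      ∀ U : (bg9Y 𝔸 G x).Cfg, (bg9Y 𝔸 G x).Reg335 c35 α₀ U → Blk348At x.toKIdx (𝔏 x).parS (𝔏 x).Gp U B₁ δ₁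

variable {𝔸 G}

/-- the members of record live in print's units: `η = L^{−k}` of the reading IS `|c_f|⁻¹` of the geometry (`MemberY.hcfk`). [cite: Balaban1984PropagatorsII, (2.1) p.224 («η = L^{−k}»)] -/
theorem etaS_eq_abs_cf_inv (x : MemberY d ℓ hd hL b₀ b₁ Mstar) : etaS x.toKIdx = |x.cf|⁻¹ := by
  unfold etaS nKT
  rw [x.hcfk, abs_of_nonneg (by positivity)]
  push_cast
  rfl

/-- **THE RECORD GEOMETRY's SCALE AT AN INDEX BOND IS THE TORUS LENGTH OF ITS CARRIER BLOCK**: `(geo9Y x).len b = L^{j(βb)}·η = lenB (βb)`.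
[cite: Balaban1985BackgroundPropagators, (3.41) p.397 («Lʲη»); Balaban1984PropagatorsII, (2.1) p.224] -/
theorem geo9Y_len_eq_lenB (x : MemberY d ℓ hd hL b₀ b₁ Mstar) (b : (geo9Y x).Site) :
    (geo9Y x).len b = lenB x.toKIdx (β x.hN x.D x.hk b) := by
  have hk1 : 1 ≤ x.k := le_trans one_le_two x.hk2
  rw [lenB_eq, etaS_eq_abs_cf_inv]
  show (((ℓ + 1 : ℕ) : ℝ)) ^ (lvl x.hN x.D x.hk b) * |x.cf|⁻¹ = _
  rw [← beta_level x.hN x.D x.hk hk1 b]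
  push_cast
  rfl

/-- **THE RECORD GEOMETRY's DISTANCE IS THE TORUS DISTANCE OF THE CARRIER BLOCKS** (`rfl`). [cite: Balaban1984PropagatorsII, (2.46) p.231] -/
theorem geo9Y_dist_eq_distB (x : MemberY d ℓ hd hL b₀ b₁ Mstar) (b b' : (geo9Y x).Site) :
    (geo9Y x).dist b b' = distB x.toKIdx (β x.hN x.D x.hk b) (β x.hN x.D x.hk b') := rfl

/-- `(geo9Y x).M = L·M_h` in the torus currency. [cite: Balaban1984PropagatorsII, (2.2) p.224, bookkeeping] -/
theorem geo9Y_M_eq (x : MemberY d ℓ hd hL b₀ b₁ Mstar) : (geo9Y x).M = ((ℓ : ℝ) + 1) * x.Mh := by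
  rw [B9PinMembersKLevelV1.geo9Y_M]; push_cast; ring

/-- n06-i's reading at the carrier blocks, unfolded. [cite: Balaban1985BackgroundPropagators, (3.49) p.399, bookkeeping] -/
theorem p349SiteY_ker (x : MemberY d ℓ hd hL b₀ b₁ Mstar) (𝔏 : CovLettersY 𝔸 x) (n : Fin 4) (U : (bg9Y 𝔸 G x).Cfg) (b b' : (geo9Y x).Site) :
    (p349SiteY 𝔸 G x 𝔏).ker n U b b' = fineEntryS x.toKIdx (P349Y x.toKIdx 𝔏.parS 𝔏.Gp) U (β x.hN x.D x.hk b) (β x.hN x.D x.hk b') n := rfl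

end Family

/-! ## §3 Row 25 derived at the record geometry -/

section Record

variable {𝔸 : Type} [NormedRing 𝔸] [NormedAlgebra ℂ 𝔸] [CompleteSpace 𝔸] {G : Subgroup 𝔸ˣ}

/-- ★★★ **ROW 25 OF THE N06 TABLE DERIVED: THE PRINTED (3.49) FOR THE GENUINE `P = I − R(U)` OF A LETTER FAMILY, READ AT THE CARRIER BLOCKS, FROM
BLOCK-COMPLETE THM 3.1 ∕ THM 3.2-TYPE INPUTS** — `B9.Stmt349Printed (d+1) c35 geo9Y (bg9Y 𝔸 G) (x ↦ p349SiteY 𝔸 G x (𝔏 x))` («These theorems [3.1, 3.2]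
imply … using again Lemma 2.1 … (3.49)»): thresholds merged (`M₁ := max`, `a₀ := min`), the rate `θ = min(δ₀,δ₁)∕8` displayed as `½·(2θ)`, the constant
`B₀B₁B₀·C_g`; at def-Y's records (`lettersYOfRecordDE`) and n06-i's instance `opsYS349OfRecordDE` this is the knit's binder `s349` from the two inputs.
Honest: the inputs are hypotheses (printed-type, block-complete; adjoint side located); everything downstream is proved.
[cite: Balaban1985BackgroundPropagators, (3.49) p.399; Thm 3.1 (3.42) p.397; Thm 3.2 (3.48) p.398; Balaban1984PropagatorsII, Lemma 2.1 p.234] -/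
theorem stmt349Printed_site_of_blockSchemas {c35 : ℝ} (𝔏 : ∀ x : MemberY d ℓ hd hL b₀ b₁ Mstar, CovLettersY 𝔸 x)
    (h31 : Thm31SiteSchemas 𝔸 G c35 𝔏) (h32 : Thm32BlkSchema 𝔸 G c35 𝔏) :
    B9.Stmt349Printed (d + 1) c35 (geo9Y (d := d) (ℓ := ℓ) (hd := hd) (hL := hL) (b₀ := b₀) (b₁ := b₁) (Mstar := Mstar)) (bg9Y 𝔸 G)
      (fun x => p349SiteY 𝔸 G x (𝔏 x)) := by
  obtain ⟨M₁, δ₀, a₀, B₀, hM₁, hδ₀, ha₀, hB₀, H31⟩ := h31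
  obtain ⟨M₁', δ₁, a₀', B₁, hM₁', hδ₁, ha₀', hB₁, H32⟩ := h32
  obtain ⟨M₃, θ, Cg, hM₃, hθ, hCg, -, H⟩ := exists_threshold_349 (d := d) (ℓ := ℓ) (hd := hd) (hL := hL) (b₀ := b₀) (b₁ := b₁) hδ₀ hδ₁
  refine ⟨max M₁ (max M₁' M₃), 2 * θ, min a₀ a₀', B₀ * B₁ * B₀ * Cg, lt_max_of_lt_left hM₁, by positivity, lt_min ha₀ ha₀', by positivity, ?_⟩
  intro x hMx α₀ hα₀ hMa U hU n b b'
  have hM1 : M₁ ≤ (geo9Y x).M := (le_max_left _ _).trans hMx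
  have hM1' : M₁' ≤ (geo9Y x).M := ((le_max_left _ _).trans (le_max_right _ _)).trans hMx
  have hM3 : M₃ ≤ ((ℓ : ℝ) + 1) * x.Mh := by rw [← geo9Y_M_eq]; exact ((le_max_right _ _).trans (le_max_right _ _)).trans hMx
  obtain ⟨hLe, hRi⟩ := H31 x hM1 α₀ hα₀ (hMa.trans (min_le_left _ _)) U hU
  have h348 := H32 x hM1' α₀ hα₀ (hMa.trans (min_le_right _ _)) U hU
  have key := H x.toKIdx hM3 (𝔏 x).parS (𝔏 x).Gp U hB₀.le hB₁.le hLe hRi h348 n (β x.hN x.D x.hk b) (β x.hN x.D x.hk b')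
  rw [p349SiteY_ker, geo9Y_len_eq_lenB, geo9Y_len_eq_lenB, geo9Y_dist_eq_distB,
    show 2 * θ / 2 = θ by ring]
  exact key

end Record

end

end Literature.MathematicalPhysics.QuantumFieldTheory.Balaban1983to89.B9Ineq349SiteFromBlocks
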